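import Summits.QuantumFields.YangMills.Theorems.OneCertifiedCubeCrossoverCertificateFrozenSU2Angle
import Summits.QuantumFields.YangMills.Theorems.OneCertifiedCubeCrossoverCertificateFrozenStokes
import Summits.QuantumFields.YangMills.Theorems.OneCertifiedCubeCrossoverCertificateFrozenGeometry

/-!
# The centre-twisted abelian boundary condition: loop holonomy `-1` around every `(0,1)`-slice of the cube

Helper file for the frozen-coupling analysis of crux `CrossoverCertificate` (stmt-QuantumFields-16125).
Fix the cube edge set `A` (a box of edges, `FrozenGeometry`), its lower corner coordinate `L = lo - 1` and
`S = side + 1`, the diagonal one-parameter subgroup `D` of `SU(2)` (`FrozenSU2Angle`) and an angle `α`.  The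
ABELIAN TWIST FIELD `Uab` carries `D (α φ(y))` on the links in direction `1` and `1` on all other links, where
`φ(y) = (y₀ - L) - [y₁ = L ∧ y₀ ≥ L + 1]` counts the slice plaquettes to the left of the link; its `(0,1)`-curvature
is `D α` on every plaquette of the slice region except the corner plaquette (curvature `1`), and trivial in
all other planes.  For ANY configuration `U` that agrees with `Uab` OFF the cube (i.e. `U = ζ ∨ η′` glued with
the twisted boundary condition) we compute, slice by slice (`σ = (x₂, x₃)`):

* the holonomy of the boundary loop of the slice rectangle `[L, L+S]²` is `D (α (S² - 1))`
  (`walkHolonomy_sliceLoop`), all its links lying off the cube;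
* the corner plaquette is trivial (`plaquetteHolonomyZd_sliceCorner`);
* hence, by the lattice Stokes bound with the rotation angle `ang` (`FrozenStokes`, `FrozenSU2Angle`), if
  `α (S² - 1) = π` the angles of the `S² - 1` non-corner plaquettes of the slice sum to at least `π`
  (`pi_le_sum_ang_slice`).

All objects enter as hypotheses (`hA`, `hL`, `hUab`, `hU`, …); no definition is introduced.
-/

noncomputable section

namespace Summit.QuantumFields.YangMills.Theorems.CrossoverCertificate.Negative

open Finset Real
open Literature.MathematicalPhysics.QuantumLattice Literature.Probability.LatticeModels
open Summit.QuantumFields.YangMills.Theorems.CovarianceBound.Negative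

/-! ### Straight-walk holonomies in a one-parameter subgroup -/

/-- If every link of a straight walk lies in the one-parameter subgroup `D`, `U (y + k eᵢ, i) = D (g k)`, then the
holonomy of the walk is `D (∑ g k)`. [folklore] -/
theorem walkHolonomy_lineWalk_eq_oneParam (D : ℝ → Matrix.specialUnitaryGroup (Fin 2) ℂ)
    (hD : ∀ s t : ℝ, D (s + t) = D s * D t) (hD0 : D 0 = 1)
    (U : LGConfig 4 (Matrix.specialUnitaryGroup (Fin 2) ℂ)) (i : Fin 4) (y : Site 4) (g : ℕ → ℝ) :
    ∀ m : ℕ, (∀ k, k < m → U (y + Pi.single i (k : ℤ), i) = D (g k)) →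
      walkHolonomy U (lineWalk i m y) = D (∑ k ∈ Finset.range m, g k)
  | 0, _ => by rw [walkHolonomy_lineWalk_zero, Finset.sum_range_zero, hD0]
  | m + 1, h => by
    rw [walkHolonomy_lineWalk_succ', walkHolonomy_lineWalk_eq_oneParam D hD hD0 U i y g m
      (fun k hk => h k (Nat.lt_succ_of_lt hk)), h m (Nat.lt_succ_self m), Finset.sum_range_succ, hD]

section Twist

variable {b n : ℕ} {A : Finset (ZdEdge 4)} {L : ℤ} {S : ℕ}
  {D : ℝ → Matrix.specialUnitaryGroup (Fin 2) ℂ} {α : ℝ}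
  {Uab U : LGConfig 4 (Matrix.specialUnitaryGroup (Fin 2) ℂ)}

/-- **Off-cube test.** An edge based at a site with coordinate `0` or `1` equal to `L = lo - 1` or to
`L + S = hi + 1` is not a cube edge. [folklore] -/
theorem not_mem_cube_of_coord (hb : 0 < b)
    (hA : A = (Finset.biUnion (Fintype.piFinset fun _ : Fin 4 => Finset.Icc (-(2 * ((n : ℕ) : ℤ))) (2 * ((n : ℕ) : ℤ))) (fun y : Fin 4 → ℤ => (Fintype.piFinset fun i : Fin 4 => Finset.Ico (((b : ℕ) : ℤ) * y i) (((b : ℕ) : ℤ) * (y i + 1))) ×ˢ (Finset.univ : Finset (Fin 4)))))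
    (hL : L = -(2 * (n : ℤ) * b) - 1) (hS : S = (4 * n + 1) * b + 1) {z : Site 4} {μ : Fin 4} {i : Fin 4}
    (hz : z i = L ∨ z i = L + S) : (z, μ) ∉ A := by
  rw [hA]
  rcases hz with hz | hz
  · exact not_mem_cubeEdges_of_lt hb (i := i) (by rw [hz, hL]; linarith)
  · refine not_mem_cubeEdges_of_gt hb (i := i) ?_
    rw [hz, hL, hS]; push_cast; nlinarith

/-- The twist field is `1` on every link not in direction `1`. [folklore] -/
theorem twist_apply_of_ne_one
    (hUab : ∀ (y : Site 4) (μ : Fin 4), Uab (y, μ) =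
      if μ = 1 then D (α * (((y 0 - L : ℤ) : ℝ) - if y 1 = L ∧ L + 1 ≤ y 0 then 1 else 0)) else 1)
    (y : Site 4) {μ : Fin 4} (hμ : μ ≠ 1) : Uab (y, μ) = 1 := by
  rw [hUab, if_neg hμ]

/-- The twist field on a link in direction `1`. [folklore] -/
theorem twist_apply_one
    (hUab : ∀ (y : Site 4) (μ : Fin 4), Uab (y, μ) =
      if μ = 1 then D (α * (((y 0 - L : ℤ) : ℝ) - if y 1 = L ∧ L + 1 ≤ y 0 then 1 else 0)) else 1)
    (y : Site 4) : Uab (y, 1) = D (α * (((y 0 - L : ℤ) : ℝ) - if y 1 = L ∧ L + 1 ≤ y 0 then 1 else 0)) := by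
  rw [hUab, if_pos rfl]

/-! ### The four sides of the slice loop -/

/-- **Bottom side** (direction `0`, coordinate `1` equal to `L`): holonomy `1`. [folklore] -/
theorem walkHolonomy_sliceBottom (hb : 0 < b)
    (hA : A = (Finset.biUnion (Fintype.piFinset fun _ : Fin 4 => Finset.Icc (-(2 * ((n : ℕ) : ℤ))) (2 * ((n : ℕ) : ℤ))) (fun y : Fin 4 → ℤ => (Fintype.piFinset fun i : Fin 4 => Finset.Ico (((b : ℕ) : ℤ) * y i) (((b : ℕ) : ℤ) * (y i + 1))) ×ˢ (Finset.univ : Finset (Fin 4)))))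
    (hL : L = -(2 * (n : ℤ) * b) - 1) (hS : S = (4 * n + 1) * b + 1)
    (hD : ∀ s t : ℝ, D (s + t) = D s * D t) (hD0 : D 0 = 1)
    (hUab : ∀ (y : Site 4) (μ : Fin 4), Uab (y, μ) =
      if μ = 1 then D (α * (((y 0 - L : ℤ) : ℝ) - if y 1 = L ∧ L + 1 ≤ y 0 then 1 else 0)) else 1)
    (hU : ∀ e, e ∉ A → U e = Uab e) (σ : ℤ × ℤ) (m : ℕ) :
    walkHolonomy U (lineWalk 0 m (Pi.single 0 L + Pi.single 1 L + Pi.single 2 σ.1 + Pi.single 3 σ.2 : Site 4)) = 1 := by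
  rw [walkHolonomy_lineWalk_eq_oneParam D hD hD0 U 0 _ (fun _ => 0) m, Finset.sum_const_zero, hD0]
  intro k _
  rw [hU _ (not_mem_cube_of_coord hb hA hL hS (i := 1) (Or.inl (by simp))),
    twist_apply_of_ne_one hUab _ (μ := 0) (by decide)]
  exact hD0.symm

/-- **Top side** (direction `0`, coordinate `1` equal to `L + S`): holonomy `1`. [folklore] -/
theorem walkHolonomy_sliceTop (hb : 0 < b)
    (hA : A = (Finset.biUnion (Fintype.piFinset fun _ : Fin 4 => Finset.Icc (-(2 * ((n : ℕ) : ℤ))) (2 * ((n : ℕ) : ℤ))) (fun y : Fin 4 → ℤ => (Fintype.piFinset fun i : Fin 4 => Finset.Ico (((b : ℕ) : ℤ) * y i) (((b : ℕ) : ℤ) * (y i + 1))) ×ˢ (Finset.univ : Finset (Fin 4)))))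
    (hL : L = -(2 * (n : ℤ) * b) - 1) (hS : S = (4 * n + 1) * b + 1)
    (hD : ∀ s t : ℝ, D (s + t) = D s * D t) (hD0 : D 0 = 1)
    (hUab : ∀ (y : Site 4) (μ : Fin 4), Uab (y, μ) =
      if μ = 1 then D (α * (((y 0 - L : ℤ) : ℝ) - if y 1 = L ∧ L + 1 ≤ y 0 then 1 else 0)) else 1)
    (hU : ∀ e, e ∉ A → U e = Uab e) (σ : ℤ × ℤ) (m : ℕ) :
    walkHolonomy U (lineWalk 0 m ((Pi.single 0 L + Pi.single 1 L + Pi.single 2 σ.1 + Pi.single 3 σ.2 : Site 4) +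
      Pi.single 1 (S : ℤ))) = 1 := by
  rw [walkHolonomy_lineWalk_eq_oneParam D hD hD0 U 0 _ (fun _ => 0) m, Finset.sum_const_zero, hD0]
  intro k _
  rw [hU _ (not_mem_cube_of_coord hb hA hL hS (i := 1) (Or.inr (by simp))),
    twist_apply_of_ne_one hUab _ (μ := 0) (by decide)]
  exact hD0.symm

/-- **Left side** (direction `1`, coordinate `0` equal to `L`): the twist counts no plaquette, holonomy `1`.
[folklore] -/
theorem walkHolonomy_sliceLeft (hb : 0 < b)
    (hA : A = (Finset.biUnion (Fintype.piFinset fun _ : Fin 4 => Finset.Icc (-(2 * ((n : ℕ) : ℤ))) (2 * ((n : ℕ) : ℤ))) (fun y : Fin 4 → ℤ => (Fintype.piFinset fun i : Fin 4 => Finset.Ico (((b : ℕ) : ℤ) * y i) (((b : ℕ) : ℤ) * (y i + 1))) ×ˢ (Finset.univ : Finset (Fin 4)))))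
    (hL : L = -(2 * (n : ℤ) * b) - 1) (hS : S = (4 * n + 1) * b + 1)
    (hD : ∀ s t : ℝ, D (s + t) = D s * D t) (hD0 : D 0 = 1)
    (hUab : ∀ (y : Site 4) (μ : Fin 4), Uab (y, μ) =
      if μ = 1 then D (α * (((y 0 - L : ℤ) : ℝ) - if y 1 = L ∧ L + 1 ≤ y 0 then 1 else 0)) else 1)
    (hU : ∀ e, e ∉ A → U e = Uab e) (σ : ℤ × ℤ) (m : ℕ) :
    walkHolonomy U (lineWalk 1 m (Pi.single 0 L + Pi.single 1 L + Pi.single 2 σ.1 + Pi.single 3 σ.2 : Site 4)) = 1 := by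
  rw [walkHolonomy_lineWalk_eq_oneParam D hD hD0 U 1 _ (fun _ => 0) m, Finset.sum_const_zero, hD0]
  intro k _
  rw [hU _ (not_mem_cube_of_coord hb hA hL hS (i := 0) (Or.inl (by simp))), twist_apply_one hUab]
  congr 1
  simp

/-- **Right side** (direction `1`, coordinate `0` equal to `L + S`): the twist counts `S` plaquettes per row,
`S - 1` in the bottom row; holonomy `D (α (S·S - 1))`. [folklore] -/
theorem walkHolonomy_sliceRight (hb : 0 < b)
    (hA : A = (Finset.biUnion (Fintype.piFinset fun _ : Fin 4 => Finset.Icc (-(2 * ((n : ℕ) : ℤ))) (2 * ((n : ℕ) : ℤ))) (fun y : Fin 4 → ℤ => (Fintype.piFinset fun i : Fin 4 => Finset.Ico (((b : ℕ) : ℤ) * y i) (((b : ℕ) : ℤ) * (y i + 1))) ×ˢ (Finset.univ : Finset (Fin 4)))))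
    (hL : L = -(2 * (n : ℤ) * b) - 1) (hS : S = (4 * n + 1) * b + 1)
    (hD : ∀ s t : ℝ, D (s + t) = D s * D t) (hD0 : D 0 = 1)
    (hUab : ∀ (y : Site 4) (μ : Fin 4), Uab (y, μ) =
      if μ = 1 then D (α * (((y 0 - L : ℤ) : ℝ) - if y 1 = L ∧ L + 1 ≤ y 0 then 1 else 0)) else 1)
    (hU : ∀ e, e ∉ A → U e = Uab e) (σ : ℤ × ℤ) :
    walkHolonomy U (lineWalk 1 S ((Pi.single 0 L + Pi.single 1 L + Pi.single 2 σ.1 + Pi.single 3 σ.2 : Site 4) +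
      Pi.single 0 (S : ℤ))) = D (α * ((S : ℝ) * S - 1)) := by
  have hS1 : 1 ≤ S := by rw [hS]; exact Nat.succ_le_succ (Nat.zero_le _)
  rw [walkHolonomy_lineWalk_eq_oneParam D hD hD0 U 1 _ (fun k => α * ((S : ℝ) - if k = 0 then 1 else 0)) S]
  · congr 1
    rw [← Finset.mul_sum, Finset.sum_sub_distrib, Finset.sum_const, Finset.card_range, nsmul_eq_mul,
      Finset.sum_ite_eq' (Finset.range S) 0 (fun _ => (1 : ℝ)), if_pos (Finset.mem_range.2 hS1)]
  · intro k _
    rw [hU _ (not_mem_cube_of_coord hb hA hL hS (i := 0) (Or.inr (by simp))), twist_apply_one hUab]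
    congr 1
    have h0 : (((Pi.single 0 L + Pi.single 1 L + Pi.single 2 σ.1 + Pi.single 3 σ.2 : Site 4) +
        Pi.single 0 (S : ℤ) + Pi.single 1 (k : ℤ) : Site 4)) 0 = L + S := by simp
    have h1 : (((Pi.single 0 L + Pi.single 1 L + Pi.single 2 σ.1 + Pi.single 3 σ.2 : Site 4) +
        Pi.single 0 (S : ℤ) + Pi.single 1 (k : ℤ) : Site 4)) 1 = L + k := by simp
    rw [h0, h1]
    have hS1' : (1 : ℤ) ≤ S := by exact_mod_cast hS1
    by_cases hk : k = 0 <;> simp [hk, hS1']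

/-- **The slice loop.** The boundary loop of the slice rectangle `[L, L+S]²` (the rectangular walk
`rectWalk x_σ 0 1 S S`) has holonomy `D (α (S² - 1))`. [folklore] -/
theorem walkHolonomy_sliceLoop (hb : 0 < b)
    (hA : A = (Finset.biUnion (Fintype.piFinset fun _ : Fin 4 => Finset.Icc (-(2 * ((n : ℕ) : ℤ))) (2 * ((n : ℕ) : ℤ))) (fun y : Fin 4 → ℤ => (Fintype.piFinset fun i : Fin 4 => Finset.Ico (((b : ℕ) : ℤ) * y i) (((b : ℕ) : ℤ) * (y i + 1))) ×ˢ (Finset.univ : Finset (Fin 4)))))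
    (hL : L = -(2 * (n : ℤ) * b) - 1) (hS : S = (4 * n + 1) * b + 1)
    (hD : ∀ s t : ℝ, D (s + t) = D s * D t) (hD0 : D 0 = 1)
    (hUab : ∀ (y : Site 4) (μ : Fin 4), Uab (y, μ) =
      if μ = 1 then D (α * (((y 0 - L : ℤ) : ℝ) - if y 1 = L ∧ L + 1 ≤ y 0 then 1 else 0)) else 1)
    (hU : ∀ e, e ∉ A → U e = Uab e) (σ : ℤ × ℤ) :
    walkHolonomy U (rectWalk (Pi.single 0 L + Pi.single 1 L + Pi.single 2 σ.1 + Pi.single 3 σ.2 : Site 4) 0 1 S S) =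
      D (α * ((S : ℝ) * S - 1)) := by
  rw [walkHolonomy_rectWalk, walkHolonomy_sliceBottom hb hA hL hS hD hD0 hUab hU σ S,
    walkHolonomy_sliceRight hb hA hL hS hD hD0 hUab hU σ, walkHolonomy_sliceTop hb hA hL hS hD hD0 hUab hU σ S,
    walkHolonomy_sliceLeft hb hA hL hS hD hD0 hUab hU σ S]
  group

/-- **The corner plaquette is trivial**: all four of its links lie off the cube and the twist is flat there.
[folklore] -/
theorem plaquetteHolonomyZd_sliceCorner (hb : 0 < b)
    (hA : A = (Finset.biUnion (Fintype.piFinset fun _ : Fin 4 => Finset.Icc (-(2 * ((n : ℕ) : ℤ))) (2 * ((n : ℕ) : ℤ))) (fun y : Fin 4 → ℤ => (Fintype.piFinset fun i : Fin 4 => Finset.Ico (((b : ℕ) : ℤ) * y i) (((b : ℕ) : ℤ) * (y i + 1))) ×ˢ (Finset.univ : Finset (Fin 4)))))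
    (hL : L = -(2 * (n : ℤ) * b) - 1) (hS : S = (4 * n + 1) * b + 1) (hD0 : D 0 = 1)
    (hUab : ∀ (y : Site 4) (μ : Fin 4), Uab (y, μ) =
      if μ = 1 then D (α * (((y 0 - L : ℤ) : ℝ) - if y 1 = L ∧ L + 1 ≤ y 0 then 1 else 0)) else 1)
    (hU : ∀ e, e ∉ A → U e = Uab e) (σ : ℤ × ℤ) :
    plaquetteHolonomyZd U (Pi.single 0 L + Pi.single 1 L + Pi.single 2 σ.1 + Pi.single 3 σ.2 : Site 4) 0 1 = 1 := by
  unfold plaquetteHolonomyZd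
  rw [hU _ (not_mem_cube_of_coord hb hA hL hS (i := 1) (Or.inl (by simp))),
    hU _ (not_mem_cube_of_coord hb hA hL hS (i := 1) (Or.inl (by simp))),
    hU _ (not_mem_cube_of_coord hb hA hL hS (i := 0) (Or.inl (by simp))),
    hU _ (not_mem_cube_of_coord hb hA hL hS (i := 0) (Or.inl (by simp))),
    twist_apply_of_ne_one hUab _ (μ := 0) (by decide), twist_apply_of_ne_one hUab _ (μ := 0) (by decide),
    twist_apply_one hUab, twist_apply_one hUab]
  simp [hD0]

/-- **Frustration of every slice.** If `α (S² - 1) = π`, `α ∈ [0, π]`... precisely if `D (α (S·S - 1))` has angle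
`π`, then for every configuration agreeing with the twisted boundary condition off the cube the rotation angles of
the `S² - 1` non-corner `(0,1)`-plaquettes of each slice sum to at least `π` (lattice Stokes bound +
conjugation-invariant subadditive angle). [folklore] -/
theorem pi_le_sum_ang_slice (hb : 0 < b)
    (hA : A = (Finset.biUnion (Fintype.piFinset fun _ : Fin 4 => Finset.Icc (-(2 * ((n : ℕ) : ℤ))) (2 * ((n : ℕ) : ℤ))) (fun y : Fin 4 → ℤ => (Fintype.piFinset fun i : Fin 4 => Finset.Ico (((b : ℕ) : ℤ) * y i) (((b : ℕ) : ℤ) * (y i + 1))) ×ˢ (Finset.univ : Finset (Fin 4)))))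
    (hL : L = -(2 * (n : ℤ) * b) - 1) (hS : S = (4 * n + 1) * b + 1)
    (hD : ∀ s t : ℝ, D (s + t) = D s * D t) (hD0 : D 0 = 1) (hDπ : ang (D (α * ((S : ℝ) * S - 1))) = π)
    (hUab : ∀ (y : Site 4) (μ : Fin 4), Uab (y, μ) =
      if μ = 1 then D (α * (((y 0 - L : ℤ) : ℝ) - if y 1 = L ∧ L + 1 ≤ y 0 then 1 else 0)) else 1)
    (hU : ∀ e, e ∉ A → U e = Uab e) (σ : ℤ × ℤ) :
    π ≤ ∑ uv ∈ ((Finset.range S) ×ˢ (Finset.range S)).erase (0, 0),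
      ang (plaquetteHolonomyZd U ((Pi.single 0 L + Pi.single 1 L + Pi.single 2 σ.1 + Pi.single 3 σ.2 : Site 4) +
        Pi.single 0 (uv.1 : ℤ) + Pi.single 1 (uv.2 : ℤ)) 0 1) := by
  have hS1 : 1 ≤ S := by rw [hS]; exact Nat.succ_le_succ (Nat.zero_le _)
  have hstokes := le_sum_plaquettes_of_subadditive_d4 ang (fun a c => ang_conj a c) ang_mul_le_add ang_one_le U
    (Pi.single 0 L + Pi.single 1 L + Pi.single 2 σ.1 + Pi.single 3 σ.2 : Site 4) 0 1 S S
  rw [walkHolonomy_sliceLoop hb hA hL hS hD hD0 hUab hU σ, hDπ, ← Finset.sum_product'] at hstokes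
  have h00 : ((0 : ℕ), (0 : ℕ)) ∈ (Finset.range S) ×ˢ (Finset.range S) :=
    Finset.mem_product.2 ⟨Finset.mem_range.2 (by omega), Finset.mem_range.2 (by omega)⟩
  rw [← Finset.add_sum_erase _ _ h00] at hstokes
  simpa [plaquetteHolonomyZd_sliceCorner hb hA hL hS hD0 hUab hU σ, ang_one] using hstokes

/-! ### Curvature of the twist field itself -/

/-- **Interior `(0,1)`-curvature of the twist field**: away from the corner column `y₀ = L` … precisely for
`y₀ ≥ L` and `(y₀, y₁) ≠ (L, L)`, the `(0,1)`-plaquette of `Uab` based at `y` has holonomy `D α`. [folklore] -/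
theorem plaquetteHolonomyZd_twist_01 (hD : ∀ s t : ℝ, D (s + t) = D s * D t) (hD0 : D 0 = 1)
    (hUab : ∀ (y : Site 4) (μ : Fin 4), Uab (y, μ) =
      if μ = 1 then D (α * (((y 0 - L : ℤ) : ℝ) - if y 1 = L ∧ L + 1 ≤ y 0 then 1 else 0)) else 1)
    {y : Site 4} (hy0 : L ≤ y 0) (hy : ¬ (y 0 = L ∧ y 1 = L)) :
    plaquetteHolonomyZd Uab y 0 1 = D α := by
  unfold plaquetteHolonomyZd
  rw [twist_apply_of_ne_one hUab _ (μ := 0) (by decide), twist_apply_of_ne_one hUab _ (μ := 0) (by decide),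
    twist_apply_one hUab, twist_apply_one hUab, one_mul, inv_one, mul_one, oneParam_mul_inv D hD hD0, ← mul_sub]
  congr 1
  have h0 : ((y + Pi.single (0 : Fin 4) (1 : ℤ) : Site 4)) 0 = y 0 + 1 := by simp
  have h1 : ((y + Pi.single (0 : Fin 4) (1 : ℤ) : Site 4)) 1 = y 1 := by simp
  rw [h0, h1]
  by_cases hy1 : y 1 = L
  · have hy0' : L + 1 ≤ y 0 := by
      rcases lt_or_eq_of_le hy0 with h | h
      · omega
      · exact absurd ⟨h.symm, hy1⟩ hy
    rw [if_pos ⟨hy1, by omega⟩, if_pos ⟨hy1, hy0'⟩]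
    push_cast; ring
  · rw [if_neg (fun h => hy1 h.1), if_neg (fun h => hy1 h.1)]
    push_cast; ring

/-- **The twist field is flat in every plane other than `(0,1)`** (its only non-trivial links point in
direction `1` and depend on the coordinates `0, 1` only). [folklore] -/
theorem plaquetteHolonomyZd_twist_of_ne : ∀ {L : ℤ} {D : ℝ → Matrix.specialUnitaryGroup (Fin 2) ℂ} {α : ℝ} {Uab : Literature.MathematicalPhysics.QuantumLattice.LGConfig 4 (Matrix.specialUnitaryGroup (Fin 2) ℂ)}, (∀ (y : Literature.Probability.LatticeModels.Site 4) (μ : Fin 4), Uab (y, μ) = if μ = 1 then D (α * (((y 0 - L : ℤ) : ℝ) - if y 1 = L ∧ L + 1 ≤ y 0 then 1 else 0)) else 1) → ∀ (y : Literature.Probability.LatticeModels.Site 4) {i j : Fin 4}, i < j → (i, j) ≠ ((0 : Fin 4), (1 : Fin 4)) → Literature.MathematicalPhysics.QuantumLattice.plaquetteHolonomyZd Uab y i j = 1 := by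
  intro L D α Uab hUab y i j hij hne
  unfold plaquetteHolonomyZd
  have key1 : ∀ (z : Site 4) (k : Fin 4), k ≠ 1 → Uab (z, k) = 1 := fun z k hk => twist_apply_of_ne_one hUab z hk
  -- links in direction 1 at `y` and at `y + e_j` (j ≥ 2) agree
  have key2 : ∀ k : Fin 4, k ≠ 0 → k ≠ 1 → Uab (y + Pi.single k 1, 1) = Uab (y, 1) := by
    intro k hk0 hk1
    rw [twist_apply_one hUab, twist_apply_one hUab]
    have h0 : ((y + Pi.single k (1 : ℤ) : Site 4)) 0 = y 0 := by simp [hk0.symm]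
    have h1 : ((y + Pi.single k (1 : ℤ) : Site 4)) 1 = y 1 := by simp [hk1.symm]
    rw [h0, h1]
  fin_cases i <;> fin_cases j <;> simp (config := {decide := true}) at hij hne ⊢
  all_goals first
    | (rw [key1 _ 0 (by decide), key1 _ 0 (by decide), key1 _ 2 (by decide), key1 _ 2 (by decide)]; simp)
    | (rw [key1 _ 0 (by decide), key1 _ 0 (by decide), key1 _ 3 (by decide), key1 _ 3 (by decide)]; simp)
    | (rw [key1 _ 2 (by decide), key1 _ 2 (by decide), key2 2 (by decide) (by decide)]; simp)
    | (rw [key1 _ 3 (by decide), key1 _ 3 (by decide), key2 3 (by decide) (by decide)]; simp)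
    | (rw [key1 _ 2 (by decide), key1 _ 2 (by decide), key1 _ 3 (by decide), key1 _ 3 (by decide)]; simp)

end Twist

end Summit.QuantumFields.YangMills.Theorems.CrossoverCertificate.Negative

end
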